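import Summits.Parity.BatemanHorn.Theses.SelbergDelangeRigidity
import Summits.Parity.BatemanHorn.Theorems.SelbergDelangeRigidityLSDRealSegmentConclusionLow

/-!
# crux-ideate round 2, ideator 5 — `LSDRealSegment` (stmt-Parity-9770): typed CHILD STATEMENTS for the planner's split

No idea card is filed this round (see `LeversRejected-ideator5-r2.md`): every lever examined needs a beyond-level law
that is not in print.  What this sheet gives the tenure planner instead is the SPLIT BY TOTAL DEGREE recommended by all
three leads and both sibling round-2 ideators, typed over the route's own text, with its glue PROVED (sorry-free):

`QuadraticSegmentLaw → LinearPairSegmentLaw → HighDegreeSegmentLaw → LSDRealSegment`,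

the class `Σ deg fᵢ ≤ 1` being discharged by the landed theorem
`ProductAnatomySubcritical.lsdRealSegment_of_sum_natDegree_le_one` (p111579).  The three children are the crux's body
VERBATIM restricted to (one irreducible quadratic) / (two linear forms) / (total degree ≥ 3); none is weakened.
-/

open Filter Finset Polynomial
open scoped BigOperators Topology Classical

namespace Summit.Parity.BatemanHorn.Cruxes.LSDRealSegment.Ideator5R2

open Literature.NumberTheory.Sieve
open ArithmeticFunction (cardFactors)
open Summit.Parity.BatemanHorn.Theses.SelbergDelangeRigidity (LSDRealSegment)

noncomputable section

/-- The crux's body for ONE system `f : Fin k → ℤ[X]` (text copied from `SelbergDelangeRigidity.LSDRealSegment`). -/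
def SegmentBody (k : ℕ) (f : Fin k → ℤ[X]) : Prop :=
  ∃ Λ : ℂ → ℂ, DifferentiableOn ℂ Λ (Metric.ball 0 2) ∧
    Λ 0 = (Literature.NumberTheory.Sieve.batemanHornConst f : ℂ) ∧
    ∀ y : ℝ, 5 / 4 < y → y < 7 / 4 → Filter.Tendsto (fun x : ℕ => (x : ℂ)⁻¹ *
      Complex.exp ((k : ℂ) * (1 - (y : ℂ)) * (Real.log (Real.log x) : ℂ)) *
      ∑ n ∈ Finset.range (x + 1), (y : ℂ) ^ (∑ i, ArithmeticFunction.cardFactors (((f i).eval (n : ℤ)).toNat)))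
      Filter.atTop (nhds (Λ y * Complex.exp (((y : ℂ) - 1) *
      (Real.log (∏ i, ((f i).natDegree : ℝ)) : ℂ)) * (Complex.Gamma y)⁻¹ ^ k))

/-- The crux is literally `∀ k f, IsBatemanHornSystem f → SegmentBody k f`. -/
theorem lsdRealSegment_iff : LSDRealSegment ↔ ∀ (k : ℕ) (f : Fin k → ℤ[X]), IsBatemanHornSystem f → SegmentBody k f :=
  Iff.rfl

/-- CHILD 1 (crux-grade, open): the real-segment LSD law for ONE IRREDUCIBLE QUADRATIC (`k = 1`, `deg = 2`, `D = 2`).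
why_might_fail (one line): ⇔ Hooley's divisor problem along an irreducible quadratic at NON-INTEGER exponent `y`
(`h_y`-weighted roots of `g` to moduli `x^θ`, all `θ < 2`); print: `θ ≤ 1+δ₀` (de la Bretèche–Drappeau 2020), factorable
moduli `< x^{5/4}` (Grimmelt–Merikoski arXiv:2505.00493 Thm 1.5, balanced two- and three-prime moduli uncovered at every `θ > 1`),
`y = 2` only (Hooley 1963); the one-point law `S(x,P)` is asymptotic only for `P = x^{1+o(1)}` (Merikoski, arXiv:1908.08816 §4). -/
def QuadraticSegmentLaw : Prop :=
  ∀ f : Fin 1 → ℤ[X], IsBatemanHornSystem f → (f 0).natDegree = 2 → SegmentBody 1 f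

/-- CHILD 2 (crux-grade, open): the law for TWO LINEAR FORMS (`k = 2`, degrees `(1,1)`, `D = 1`).
why_might_fail: ⇔ the binary additive divisor problem for `τ_y ⋆ τ_y`, `5/4 < y < 7/4`, in fixed progressions; print has it
only with one factor `τ` (Drappeau 2017; Drappeau–Topacogullari 2019) or on average over shifts (Matomäki–Radziwiłł–Tao 2019);
the tree's DFI-1997 rung reaches modulus level `θ < 96/95` (`rowsDFI_linearPair`, p124293); `θ → 2` is Elliott–Halberstam depth. -/
def LinearPairSegmentLaw : Prop :=
  ∀ f : Fin 2 → ℤ[X], IsBatemanHornSystem f → (f 0).natDegree = 1 → (f 1).natDegree = 1 → SegmentBody 2 f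

/-- CHILD 3 (crux-grade, open; for the UNCAPPED statistic strictly harder than the sibling's `hR`): every Bateman–Horn system of
total degree `≥ 3`.  why_might_fail: open already at `y = 2` for one cubic (`Σ τ(n³+2)`: order of magnitude only); the kernel
carries averaged Bateman–Horn / `P₂` content of the rough parts (Disproof §8(b)) — `SelbergParityBarrier` engaged; members of
degree `≥ 5` additionally need the tilted mass of `{n : p² ∣ fᵢ(n), p > x}` to vanish (large square factors; Granville 1998 under ABC only). -/
def HighDegreeSegmentLaw : Prop :=
  ∀ (k : ℕ) (f : Fin k → ℤ[X]), IsBatemanHornSystem f → 3 ≤ ∑ i, (f i).natDegree → SegmentBody k f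

/-- **Glue for the split (PROVED)**: the three children and the landed total-degree-`≤ 1` theorem give the crux by name. -/
theorem lsdRealSegment_of_children (hQ : QuadraticSegmentLaw) (hP : LinearPairSegmentLaw)
    (hH : HighDegreeSegmentLaw) : LSDRealSegment := by
  intro k f hf
  rcases Nat.lt_or_ge (∑ i, (f i).natDegree) 3 with hlt | hge
  · rcases Nat.lt_or_ge (∑ i, (f i).natDegree) 2 with hlt2 | hge2
    · -- total degree ≤ 1: landed theorem (p111579)
      exact ProductAnatomySubcritical.lsdRealSegment_of_sum_natDegree_le_one k f hf (by omega)
    · -- total degree = 2: k = 1 (one quadratic) or k = 2 (two linear forms)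
      have h2 : (∑ i, (f i).natDegree) = 2 := by omega
      have hpos : ∀ i, 1 ≤ (f i).natDegree := fun i => hf.natDegree_pos i
      have hk_le : k ≤ 2 := by
        have : (∑ _i : Fin k, (1 : ℕ)) ≤ ∑ i, (f i).natDegree := Finset.sum_le_sum fun i _ => hpos i
        simpa [h2] using this
      have hk_pos : 1 ≤ k := by
        by_contra hk0
        have hk : k = 0 := by omega
        subst hk
        simp at h2
      obtain rfl | rfl : k = 1 ∨ k = 2 := by omega
      · have hd : (f 0).natDegree = 2 := by simpa [Fin.sum_univ_one] using h2
        exact hQ f hf hd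
      · have hsum : (f 0).natDegree + (f 1).natDegree = 2 := by simpa [Fin.sum_univ_two] using h2
        have h0 := hpos 0
        have h1 := hpos 1
        exact hP f hf (by omega) (by omega)
  · exact hH k f hf hge

/-! ### Calibration members of the children (for the split's `sources:` / numerics), as systems over `ℤ[X]` -/

/-- The first member of CHILD 1: `X² + 1`. -/
example : (![X ^ 2 + 1] : Fin 1 → ℤ[X]) 0 = X ^ 2 + 1 := rfl

/-- The mixed-degree member of CHILD 3 used in this round's falsifier run (kit j020946): `(X, X² + X + 1)`, `D = 2`, `T = 3`. -/
example : (![X, X ^ 2 + X + 1] : Fin 2 → ℤ[X]) 1 = X ^ 2 + X + 1 := rfl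

end

end Summit.Parity.BatemanHorn.Cruxes.LSDRealSegment.Ideator5R2
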